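import Summits.HodgeConjecture.HodgeConjecture.Theorems.F0P3bStubT6kU21PGeometry
import Literature.NumberTheory.Automorphic.GKModules
import HarnessLib

/-!
# FLOOR-0 P3b «ENGINE local packets» — glue for the T6r closer: values of type-`δ` `(𝔤, K)`-1-cochains of `U(α, β)`
# and `(𝔤, K)`-submodules under equivariant linear maps between pair data

Cell hodgecm-mathlib, FLOOR 0, crux item H413 = stmt-HodgeConjecture-24833; sub-line
`Cruxes/H413/Lines/F0_EngineLocalPackets.lean` (edition 2.1), serving the closer of the registered stub **T6r**
`stub_T6r_pNullRigidity` (`Theorems/F0P3bStubT6rPNullRigidity.lean`).  PROOF lane (theorems only, no `def`); author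
F0P3-p03 (g2).  Complements (and imports) the generic §1 of ★ `F0P3bStubT6kU21PGeometry` (F0P3-p04 (g2)):
`cochainOne_apply_add/smul`, `cochainOne_eq_zero`, `apply_eq_zero_of_mem_kInLie`, `lie_apply_of_mem_kInLie`, `kAct_apply`,
`apply_lie_upqZ0` are used from there, not restated.

* §1 `cochainOne_exists_apply_ne_zero`, `cochainOne_apply_zero`, `gkOne_K_apply` (`ρK(k) f(X) = f(Ad k X)` without the
  `GKCarrier` dress) and **`typeOne_smul_apply_eq`**: for a `(𝔤, K)`-1-cochain `f` of type `δ` with `δ² = 1`, EVERY complex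
  multiple of a value is a value, `c · f(X) = f((Re c) X + δ (Im c) ⁅z₀, X⁆)` — by a formula for the argument that does not
  involve `f` (so it serves two cochains `f`, `f′` at once: the graph `{(f Z, f′ Z)}` is a complex subspace).
* §2 for two pair data `(σK, σ𝔤)` on `P` and `(ρK, ρ𝔤)` on `V` over `U(α, β)` and a `ℂ`-linear `π : P → V` intertwining
  both actions: the image of a `(𝔤, K)`-submodule (`IsGKSubmodule`) is a `(𝔤, K)`-submodule (`isGKSubmodule_map`), and so
  is its intersection with `ker π` (`isGKSubmodule_inf_ker`).  [KnappVogan1995 §II.4: kernels and images of `(𝔤, K)`-maps.]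

References: A. Borel, N. Wallach, *Continuous cohomology, discrete subgroups, and representations of reductive groups*, 2nd ed.,
AMS 2000, I §5.1, II §4.2 [BorelWallach2000]; A. Knapp, D. Vogan, *Cohomological induction and unitary representations*,
Princeton 1995, §II.4 [KnappVogan1995].

HONEST LABEL: HC_CM is proved only modulo the printed citations until rung 0 closes; this file discharges none of them.
-/

-- Mathlib idiom (as in `GKModules`, `GKCohomology`, the `Upq*` files and the Lines file): commutator bracket on `Module.End`
attribute [local instance 100] LieRing.ofAssociativeRing

set_option autoImplicit false
set_option linter.dupNamespace false

noncomputable section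

namespace Summit.HodgeConjecture.HodgeConjecture.Cruxes.H413.F0P3bGKPairGlue

open Literature.Algebra.Lie Literature.Algebra.Lie.ChevalleyEilenberg
open Literature.NumberTheory.Automorphic
open Literature.RepresentationTheory.BorelWallach2000
open Literature.RepresentationTheory.KonnoKonno2007 Literature.RepresentationTheory.KonnoKonno2007.RealDualPair
open Literature.RepresentationTheory.KonnoKonno2007.RealDualPair.UForm
open Summit.HodgeConjecture.HodgeConjecture.Cruxes.H413.F0P3bStubT6kU21PGeometry

variable {α β : Type} [Fintype α] [DecidableEq α] [Fintype β] [DecidableEq β]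

/-! ## §1 Values of `(𝔤, K)`-1-cochains of `U(α, β)` -/

section Glue

variable {V : Type} [AddCommGroup V] [Module ℂ V]
  (ρK : Representation ℂ (uFormGroup α β).maximalCompact V)
  (ρ𝔤 : (uFormGroup α β).lie →ₗ⁅ℝ⁆ Module.End ℂ V)
  (hV : ∀ (k : (uFormGroup α β).maximalCompact) (X : (uFormGroup α β).lie), ρK k ∘ₗ ρ𝔤 X ∘ₗ ρK k⁻¹ =
    ρ𝔤 ((uFormGroup α β).Ad (Subgroup.inclusion (uFormGroup α β).maximalCompact_le_carrier k) X))

/-- A non-zero `1`-cochain has a non-zero value `f(X)`. [folklore] -/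
theorem cochainOne_exists_apply_ne_zero {f : Cochain ℝ (uFormGroup α β).lie (GKCarrier (uFormGroup α β) ρ𝔤) 1}
    (h : f ≠ 0) : ∃ X : (uFormGroup α β).lie, f ![X] ≠ 0 := by
  by_contra hX
  push Not at hX
  exact h (cochainOne_eq_zero ρ𝔤 hX)

/-- `f(0) = 0` for a `1`-cochain. [folklore] -/
theorem cochainOne_apply_zero (f : Cochain ℝ (uFormGroup α β).lie (GKCarrier (uFormGroup α β) ρ𝔤) 1) :
    f ![(0 : (uFormGroup α β).lie)] = 0 := by
  have h := cochainOne_apply_smul ρ𝔤 f 0 0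
  rwa [zero_smul, Complex.ofReal_zero, zero_smul] at h

/-- **`K`-equivariance of a `(𝔤, K)`-1-cochain**, `ρK(k) f(X) = f(Ad k X)` (★ `kAct_apply` without the `GKCarrier`
dress). [cite: BorelWallach2000, I §5.1 (1)] -/
theorem gkOne_K_apply {f : Cochain ℝ (uFormGroup α β).lie (GKCarrier (uFormGroup α β) ρ𝔤) 1}
    (hf : f ∈ (gkComplex (uFormGroup α β) ρK ρ𝔤 hV).carrier 1) (k : (uFormGroup α β).maximalCompact)
    (X : (uFormGroup α β).lie) :
    ρK k (f ![X] : V) = f ![(uFormGroup α β).Ad (Subgroup.inclusion (uFormGroup α β).maximalCompact_le_carrier k) X] :=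
  kAct_apply ρK ρ𝔤 hV hf k X

/-- **Every complex multiple of a value is a value** for a `(𝔤, K)`-1-cochain of type `δ`, `δ² = 1`:
`c · f(X) = f((Re c) X + δ (Im c) ⁅z₀, X⁆)` — the formula for the argument does not involve `f`.
[cite: BorelWallach2000, II §4.2 (3)] -/
theorem typeOne_smul_apply_eq {δ : ℤ} (hδ : δ * δ = 1)
    {f : Cochain ℝ (uFormGroup α β).lie (GKCarrier (uFormGroup α β) ρ𝔤) 1} (hf : f ∈ upqType ρK ρ𝔤 hV 1 δ)
    (c : ℂ) (X : (uFormGroup α β).lie) :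
    c • (f ![X] : V) = f ![c.re • X + ((δ : ℝ) * c.im) • ⁅upqZ0 α β, X⁆] := by
  rw [cochainOne_apply_add ρ𝔤, cochainOne_apply_smul ρ𝔤, cochainOne_apply_smul ρ𝔤, apply_lie_upqZ0 ρK ρ𝔤 hV hf X,
    smul_smul, ← add_smul]
  congr 1
  have hδC : (δ : ℂ) * (δ : ℂ) = 1 := by exact_mod_cast hδ
  calc c = (c.re : ℂ) + (c.im : ℂ) * Complex.I := (Complex.re_add_im c).symm
    _ = (c.re : ℂ) + ((δ : ℂ) * (δ : ℂ)) * (c.im : ℂ) * Complex.I := by rw [hδC, one_mul]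
    _ = (c.re : ℂ) + (((δ : ℝ) * c.im : ℝ) : ℂ) * ((δ : ℂ) * Complex.I) := by push_cast; ring

end Glue



/-! ## §2 `(𝔤, K)`-submodules under equivariant linear maps between pair data -/

section Maps

variable {P : Type} [AddCommGroup P] [Module ℂ P]
  {σK : Representation ℂ (uFormGroup α β).maximalCompact P}
  {σ𝔤 : (uFormGroup α β).lie →ₗ⁅ℝ⁆ Module.End ℂ P}
  {V : Type} [AddCommGroup V] [Module ℂ V]
  {ρK : Representation ℂ (uFormGroup α β).maximalCompact V}
  {ρ𝔤 : (uFormGroup α β).lie →ₗ⁅ℝ⁆ Module.End ℂ V}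

/-- **The image of a `(𝔤, K)`-submodule under an equivariant linear map is a `(𝔤, K)`-submodule.** [cite: KnappVogan1995, §II.4] -/
theorem isGKSubmodule_map (π : P →ₗ[ℂ] V) (hK : ∀ (k : (uFormGroup α β).maximalCompact) (p : P), π (σK k p) = ρK k (π p))
    (h𝔤 : ∀ (X : (uFormGroup α β).lie) (p : P), π (σ𝔤 X p) = ρ𝔤 X (π p)) {D : Submodule ℂ P}
    (hD : IsGKSubmodule σK σ𝔤 D) : IsGKSubmodule ρK ρ𝔤 (D.map π) := by
  refine ⟨fun k v hv => ?_, fun X v hv => ?_⟩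
  · obtain ⟨p, hp, rfl⟩ := Submodule.mem_map.1 hv
    rw [← hK]
    exact Submodule.mem_map_of_mem (hD.1 k p hp)
  · obtain ⟨p, hp, rfl⟩ := Submodule.mem_map.1 hv
    rw [← h𝔤]
    exact Submodule.mem_map_of_mem (hD.2 X p hp)

/-- **The part of a `(𝔤, K)`-submodule killed by an equivariant linear map is a `(𝔤, K)`-submodule.** [cite: KnappVogan1995, §II.4] -/
theorem isGKSubmodule_inf_ker (π : P →ₗ[ℂ] V) (hK : ∀ (k : (uFormGroup α β).maximalCompact) (p : P), π (σK k p) = ρK k (π p))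
    (h𝔤 : ∀ (X : (uFormGroup α β).lie) (p : P), π (σ𝔤 X p) = ρ𝔤 X (π p)) {D : Submodule ℂ P}
    (hD : IsGKSubmodule σK σ𝔤 D) : IsGKSubmodule σK σ𝔤 (D ⊓ LinearMap.ker π) := by
  refine ⟨fun k v hv => ?_, fun X v hv => ?_⟩
  · obtain ⟨hvD, hvk⟩ := Submodule.mem_inf.1 hv
    refine Submodule.mem_inf.2 ⟨hD.1 k v hvD, ?_⟩
    rw [LinearMap.mem_ker] at hvk ⊢
    rw [hK, hvk, map_zero]
  · obtain ⟨hvD, hvk⟩ := Submodule.mem_inf.1 hv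
    refine Submodule.mem_inf.2 ⟨hD.2 X v hvD, ?_⟩
    rw [LinearMap.mem_ker] at hvk ⊢
    rw [h𝔤, hvk, map_zero]

end Maps


end Summit.HodgeConjecture.HodgeConjecture.Cruxes.H413.F0P3bGKPairGlue

end
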